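import Literature.Topology.PlanarFoliations.StarPunctures
import HarnessLib

/-!
# Generic star data: separatrices have one puncture at both ends

Topic: Topology / PlanarFoliations, sequel to `Punctures.lean` and `StarPunctures.lean`. The
**genericity hypothesis** of the planar part of Novikov's theorem
(`EssentialLeafVanishing.lean`: every separatrix in the relevant compact set has the same
puncture as α- and ω-limit) follows from a hypothesis on the 3-manifold side — **distinct saddle
punctures of the compact set have images in distinct leaves of `T`** (general position: no saddle
connections; Camacho–Lins Neto Ch. VI §3 Prop. 1 (c)):

* `PunctureData.exists_mem_fwd_level_eq` / `exists_mem_bwd_level_eq` (**proved**): a leaf end at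
  a puncture has points in the puncture ball at the level of the puncture (extracted from the
  proof of `exists_mem_levelLeaves_of_omegaSet_subset`);
* `StarData.nprong_ne_zero_of_omegaSet_subset` (**proved**): **no open leaf ends at a centre**;
* `PunctureData.apply_mem_leaf_of_omegaSet_subset` (**proved**): the image of the end puncture
  lies in the leaf of `T` of the image of the leaf (same plaque of the puncture box);
* `StarData.hgen_of_leaf_injOn` (**proved**): the genericity hypothesis from injectivity of
  `v ↦ T.leaf (g v)` on the saddle punctures of the compact set.

## References

* C. Camacho, A. Lins Neto, *Geometric Theory of Foliations*, Birkhäuser (1985), Ch. VI §3,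
  Ch. VII §2 [CamachoLinsNeto1985].
-/

noncomputable section

open Set Filter Function Metric
open _root_.Topology
open Literature.Topology.FourManifolds Literature.Topology.FourManifolds.Foliation

namespace Literature.Topology.PlanarFoliations

variable {X : Type*} [TopologicalSpace X] [T2Space X] [SecondCountableTopology X] {F : Foliation ℝ X} {ι : X → ℂ}
variable {B : Type*} [NormedAddCommGroup B] {M : Type*} [TopologicalSpace M] {T : Foliation B M} {g : ℂ → M}
variable {hbi : IsBiOriented F}

namespace PunctureData

variable (D : PunctureData F ι T g) {x : X} [NoncompactSpace (F.Leaf x)]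

/-- **A forward leaf end at the puncture `v` has points in the ball at the level of `v`.**
[folklore] -/
theorem exists_mem_fwd_level_eq {v : ℂ} (hv : v ∈ D.P) {C : Set ℂ} (hC : IsCompact C)
    (hmem : ∀ q : F.Leaf x, ι (Leaf.pt q) ∈ C) (hω : omegaSet hbi ι x ⊆ {v}) :
    ∃ p : F.Leaf x, ι (Leaf.pt p) ∈ ball v (D.rad v) ∧ D.level v (ι (Leaf.pt p)) = D.level v v := by
  obtain ⟨z, hz⟩ := omegaSet_nonempty_of_forall_mem (hbi := hbi) hC hmem
  have hzv : z = v := hω hz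
  subst hzv
  obtain ⟨p, hp⟩ := exists_image_fwd_subset hC hmem isOpen_ball (fun w hw ↦ by rw [hω hw]; exact mem_ball_self (D.rad_pos _ hv))
  have hball : ∀ q ∈ fwd hbi p, ι (Leaf.pt q) ∈ ball z (D.rad z) := fun q hq ↦ hp ⟨q, hq, rfl⟩
  have hconst : ∀ q ∈ fwd hbi p, D.level z (ι (Leaf.pt q)) = D.level z (ι (Leaf.pt p)) := fun q hq ↦
    D.level_eq_of_isPreconnected hv (isPreconnected_fwd p) hball hq (mem_fwd_self p)
  have hlev : D.level z (ι (Leaf.pt p)) = D.level z z := by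
    by_contra hne
    have hcl : z ∈ closure ((fun q : F.Leaf x ↦ ι (Leaf.pt q)) '' fwd hbi p) := (mem_omegaSet_iff.1 hz) p
    have hcont := D.continuousAt_level hv (mem_ball_self (D.rad_pos _ hv))
    have hopen : ({w | D.level z w ≠ D.level z (ι (Leaf.pt p))} ∩ ball z (D.rad z)) ∈ 𝓝 z :=
      inter_mem (hcont.preimage_mem_nhds (isOpen_ne.mem_nhds (Ne.symm hne)))
        (isOpen_ball.mem_nhds (mem_ball_self (D.rad_pos _ hv)))
    obtain ⟨w, hw, ⟨q, hq, rfl⟩⟩ := mem_closure_iff_nhds.1 hcl _ hopen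
    exact hw.1 (hconst q hq)
  exact ⟨p, hball p (mem_fwd_self p), hlev⟩

/-- **A backward leaf end at the puncture `v` has points in the ball at the level of `v`.**
[folklore] -/
theorem exists_mem_bwd_level_eq {v : ℂ} (hv : v ∈ D.P) {C : Set ℂ} (hC : IsCompact C)
    (hmem : ∀ q : F.Leaf x, ι (Leaf.pt q) ∈ C) (hα : alphaSet hbi ι x ⊆ {v}) :
    ∃ p : F.Leaf x, ι (Leaf.pt p) ∈ ball v (D.rad v) ∧ D.level v (ι (Leaf.pt p)) = D.level v v := by
  obtain ⟨z, hz⟩ := alphaSet_nonempty_of_forall_mem (hbi := hbi) hC hmem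
  have hzv : z = v := hα hz
  subst hzv
  obtain ⟨p, hp⟩ := exists_image_bwd_subset hC hmem isOpen_ball (fun w hw ↦ by rw [hα hw]; exact mem_ball_self (D.rad_pos _ hv))
  have hball : ∀ q ∈ bwd hbi p, ι (Leaf.pt q) ∈ ball z (D.rad z) := fun q hq ↦ hp ⟨q, hq, rfl⟩
  have hconst : ∀ q ∈ bwd hbi p, D.level z (ι (Leaf.pt q)) = D.level z (ι (Leaf.pt p)) := fun q hq ↦
    D.level_eq_of_isPreconnected hv (isPreconnected_bwd p) hball hq (mem_bwd_self p)
  have hlev : D.level z (ι (Leaf.pt p)) = D.level z z := by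
    by_contra hne
    have hcl : z ∈ closure ((fun q : F.Leaf x ↦ ι (Leaf.pt q)) '' bwd hbi p) := (mem_alphaSet_iff.1 hz) p
    have hcont := D.continuousAt_level hv (mem_ball_self (D.rad_pos _ hv))
    have hopen : ({w | D.level z w ≠ D.level z (ι (Leaf.pt p))} ∩ ball z (D.rad z)) ∈ 𝓝 z :=
      inter_mem (hcont.preimage_mem_nhds (isOpen_ne.mem_nhds (Ne.symm hne)))
        (isOpen_ball.mem_nhds (mem_ball_self (D.rad_pos _ hv)))
    obtain ⟨w, hw, ⟨q, hq, rfl⟩⟩ := mem_closure_iff_nhds.1 hcl _ hopen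
    exact hw.1 (hconst q hq)
  exact ⟨p, hball p (mem_bwd_self p), hlev⟩

omit [T2Space X] [SecondCountableTopology X] [NoncompactSpace (F.Leaf x)] in
/-- **The image of the end puncture lies in the leaf of `T` of the image of the leaf.**
[folklore] -/
theorem apply_mem_leaf_of_level_eq {v : ℂ} (hv : v ∈ D.P) {y : X} (hy : ι y ∈ ball v (D.rad v))
    (hlev : D.level v (ι y) = D.level v v) : g v ∈ T.leaf (g (ι y)) := by
  have hsrc : g (ι y) ∈ (D.box v).source := D.mapsTo_ball v hv hy
  have hsrcv : g v ∈ (D.box v).source := D.mapsTo_ball v hv (mem_ball_self (D.rad_pos v hv))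
  have h1 : g (ι y) ∈ plaque (D.box v) (D.level v v) := ⟨hsrc, hlev⟩
  have h2 : g v ∈ plaque (D.box v) (D.level v v) := ⟨hsrcv, rfl⟩
  exact T.plaque_subset_leaf_of_mem (D.box_mem v hv) (T.mem_leaf_self _) h1 h2

end PunctureData

namespace StarData

variable (D : StarData F ι T g)

/-- **No open leaf ends at a centre**: the end puncture of a leaf end is a saddle. [folklore] -/
theorem nprong_ne_zero_of_omegaSet_subset {x : X} [NoncompactSpace (F.Leaf x)] {v : ℂ} (hv : v ∈ D.P) {C : Set ℂ} (hC : IsCompact C)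
    (hmem : ∀ q : F.Leaf x, ι (Leaf.pt q) ∈ C) (hω : omegaSet hbi ι x ⊆ {v}) : D.nprong v ≠ 0 := by
  intro h0
  obtain ⟨p, hp, hlev⟩ := D.toPunctureData.exists_mem_fwd_level_eq hv hC hmem hω
  exact D.centre v hv h0 (Leaf.pt p) hp hlev

/-- The same for backward ends. [folklore] -/
theorem nprong_ne_zero_of_alphaSet_subset {x : X} [NoncompactSpace (F.Leaf x)] {v : ℂ} (hv : v ∈ D.P) {C : Set ℂ} (hC : IsCompact C)
    (hmem : ∀ q : F.Leaf x, ι (Leaf.pt q) ∈ C) (hα : alphaSet hbi ι x ⊆ {v}) : D.nprong v ≠ 0 := by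
  intro h0
  obtain ⟨p, hp, hlev⟩ := D.toPunctureData.exists_mem_bwd_level_eq hv hC hmem hα
  exact D.centre v hv h0 (Leaf.pt p) hp hlev

/-- **The genericity hypothesis from general position**: if the images of distinct saddle
punctures of the compact set `C` lie in distinct leaves of `T`, every open leaf in `C` with
punctures as α- and ω-limits has the same puncture at both ends. [cite: CamachoLinsNeto1985, Ch. VI §3 Prop. 1] -/
theorem hgen_of_leaf_injOn {C : Set ℂ} (hC : IsCompact C)
    (hGEN : ∀ v ∈ D.P, ∀ w ∈ D.P, v ∈ C → w ∈ C → D.nprong v ≠ 0 → D.nprong w ≠ 0 → T.leaf (g v) = T.leaf (g w) → v = w)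
    (y : X) [NoncompactSpace (F.Leaf y)] (hmem : ∀ q : F.Leaf y, ι (Leaf.pt q) ∈ C)
    (v : ℂ) (hv : v ∈ D.P) (w : ℂ) (hw : w ∈ D.P) (hω : omegaSet hbi ι y = {v}) (hα : alphaSet hbi ι y = {w}) : v = w := by
  have hvC : v ∈ C := omegaSet_subset_of_forall_mem hC.isClosed hmem (by rw [hω]; exact mem_singleton v)
  have hwC : w ∈ C := alphaSet_subset_of_forall_mem hC.isClosed hmem (by rw [hα]; exact mem_singleton w)
  have hnv := D.nprong_ne_zero_of_omegaSet_subset hv hC hmem hω.subset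
  have hnw := D.nprong_ne_zero_of_alphaSet_subset hw hC hmem hα.subset
  refine hGEN v hv w hw hvC hwC hnv hnw ?_
  obtain ⟨p, hp, hlevp⟩ := D.toPunctureData.exists_mem_fwd_level_eq hv hC hmem hω.subset
  obtain ⟨p', hp', hlevp'⟩ := D.toPunctureData.exists_mem_bwd_level_eq hw hC hmem hα.subset
  have h1 := D.toPunctureData.apply_mem_leaf_of_level_eq hv hp hlevp
  have h2 := D.toPunctureData.apply_mem_leaf_of_level_eq hw hp' hlevp'
  -- both image points are in the leaf of the image of the planar leaf
  have h3 : g (ι (Leaf.pt p')) ∈ T.leaf (g (ι (Leaf.pt p))) :=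
    D.foliated.mapsTo_leaf (Leaf.pt p) (show Leaf.pt p' ∈ F.leaf (Leaf.pt p) by
      rw [leaf_eq_of_mem (show Leaf.pt p ∈ F.leaf y from p.2)]; exact p'.2)
  rw [leaf_eq_of_mem h3] at h2
  exact (leaf_eq_of_mem h1).trans (leaf_eq_of_mem h2).symm

end StarData

end Literature.Topology.PlanarFoliations
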